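import Literature.Computability.AlgebraicComplexity.BlockSecondMoment
import HarnessLib

/-!
# The averaged quantities of the Kumar–Saraf lower bound (Kumar–Saraf 2017, Lemmas 8.3–8.7)

Topic `Literature/Computability/AlgebraicComplexity`; bookkeeping for the printed proof of
`kumarSaraf2017_imm_homDepthFour` (`HomogeneousDepthFour.lean`). The real quantities through which
the expectations of `T₂`, `T₃` are bounded (`T2Expectation.lean`, `T3Expectation.lean`,
`KSMain.lean`) and which the final numerical comparison (`KSParams.lean`, `KSMain.lean`)
controls:

* `PsiOf k N E deg same` — the per-block transfer sum (same start: weights `wOf`, different start: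
  weights `wOf0`), `PsiOf_nonneg`;
* `t1r` (`T₁` per transversal, `C(a,m) (∏ deg)^r`), `rho2` (the `T₂/T₁` ratio bound),
  `psiMax`, `codeSum`, `theta3` (the `T₃` bound), with their non-negativity.

Everything is proved; no named facts.

## References

* M. Kumar, S. Saraf, *On the power of homogeneous depth 4 arithmetic circuits*, SIAM J. Comput.
  46 (2017) 336–387 (arXiv:1404.1950): Lemmas 8.3–8.7, 9.2, 9.4.
-/

noncomputable section

namespace Literature.Computability.AlgebraicComplexity.KumarSaraf

open Finset

section Psi

variable {k N : ℕ}

/-- The transfer sum of a block for the starts `s, s'`: same-start or different-start run weights.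
[cite: KumarSaraf2017, Lemma 9.2, 9.4] -/
def PsiOf (k N : ℕ) (E : ℝ) (deg : Fin k → ℕ) (same : Bool) : ℝ :=
  ∑ A ∈ (range k).powerset, runWeight (if same then wOf E deg else wOf0 E deg) (1 / N) same A

/-- The transfer sums are non-negative. [folklore] -/
theorem PsiOf_nonneg {E : ℝ} (hE : 0 ≤ E) (deg : Fin k → ℕ) (same : Bool) : 0 ≤ PsiOf k N E deg same :=
  sum_nonneg fun A _ => by
    unfold runWeight
    refine mul_nonneg (pow_nonneg (by positivity) _) (prod_nonneg fun j _ => ?_)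
    cases same
    · exact wOf0_nonneg hE deg j
    · exact wOf_nonneg hE deg j

end Psi

section Quantities

variable (r k N q Dg : ℕ) (deg : Fin k → ℕ) (a m : ℕ)

/-- `T₁` per transversal, as a real: `C(a, m) · (∏ deg)^r`. [cite: KumarSaraf2017, Lemma 8.3] -/
def t1r : ℝ := (a.choose m : ℝ) * (∏ j, (deg j : ℝ)) ^ r

/-- The `T₂/T₁` ratio bound `ρ₂ = ((∏ deg) θ^k Ψ_same(D))^r`, `θ = (a-m)/a`, `D = a/(a-m)`.
[cite: KumarSaraf2017, Lemma 8.6] -/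
def rho2 : ℝ :=
  ((∏ j, (deg j : ℝ)) * (((a - m : ℕ) : ℝ) / a) ^ k *
    ∑ A ∈ (range k).powerset, runWeight (wOf ((a : ℝ) / ((a - m : ℕ) : ℝ)) deg) (1 / N) true A) ^ r

/-- The larger of the two transfer sums for `E = a/m`. [cite: KumarSaraf2017, Lemma 8.7] -/
def psiMax : ℝ := max (PsiOf k N ((a : ℝ) / m) deg true) (PsiOf k N ((a : ℝ) / m) deg false)

/-- The sum over the second codeword: `q^{Dg} (Ψd + (Ψmax - Ψd)/q)^r + Ψmax^r`.
[cite: KumarSaraf2017, Lemma 8.7] -/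
def codeSum : ℝ :=
  (q : ℝ) ^ Dg * (PsiOf k N ((a : ℝ) / m) deg false +
    (psiMax k N deg a m - PsiOf k N ((a : ℝ) / m) deg false) / q) ^ r + psiMax k N deg a m ^ r

/-- The bound `Θ₃` on the average of the total `T₃` sum:
`M · C(a,m) η^{rk} (∏ deg)^{2r} · codeSum`. [cite: KumarSaraf2017, Lemma 8.5] -/
def theta3 : ℝ :=
  (q : ℝ) ^ Dg * ((a.choose m : ℝ) * ((m : ℝ) / a) ^ (r * k) * ((∏ j, (deg j : ℝ)) ^ 2) ^ r) *
    codeSum r k N q Dg deg a m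

variable {r k N q Dg deg a m}

/-- `ρ₂ ≥ 0`. [folklore] -/
theorem rho2_nonneg : 0 ≤ rho2 r k N deg a m := by
  unfold rho2
  refine pow_nonneg (mul_nonneg (mul_nonneg ?_ ?_) ?_) _
  · exact prod_nonneg fun j _ => Nat.cast_nonneg _
  · exact pow_nonneg (div_nonneg (Nat.cast_nonneg _) (Nat.cast_nonneg _)) _
  · refine sum_nonneg fun A _ => ?_
    unfold runWeight
    refine mul_nonneg (pow_nonneg (by positivity) _) (prod_nonneg fun j _ => wOf_nonneg ?_ deg j)
    exact div_nonneg (Nat.cast_nonneg _) (Nat.cast_nonneg _)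

/-- `t1r ≥ 0`. [folklore] -/
theorem t1r_nonneg : 0 ≤ t1r r k deg a m := by
  unfold t1r
  exact mul_nonneg (Nat.cast_nonneg _) (pow_nonneg (prod_nonneg fun j _ => Nat.cast_nonneg _) _)

/-- `Ψmax ≥ Ψd ≥ 0`. [folklore] -/
theorem psi_nonneg : 0 ≤ PsiOf k N ((a : ℝ) / m) deg false ∧
    PsiOf k N ((a : ℝ) / m) deg false ≤ psiMax k N deg a m ∧
    PsiOf k N ((a : ℝ) / m) deg true ≤ psiMax k N deg a m := by
  have hE0 : 0 ≤ (a : ℝ) / m := div_nonneg (Nat.cast_nonneg _) (Nat.cast_nonneg _)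
  exact ⟨PsiOf_nonneg hE0 deg false, le_max_right _ _, le_max_left _ _⟩

/-- `codeSum ≥ 0`. [folklore] -/
theorem codeSum_nonneg : 0 ≤ codeSum r k N q Dg deg a m := by
  obtain ⟨hy0, hyx, -⟩ := psi_nonneg (k := k) (N := N) (deg := deg) (a := a) (m := m)
  unfold codeSum
  have hin : 0 ≤ PsiOf k N ((a : ℝ) / m) deg false +
      (psiMax k N deg a m - PsiOf k N ((a : ℝ) / m) deg false) / q :=
    add_nonneg hy0 (div_nonneg (by linarith) (Nat.cast_nonneg _))
  exact add_nonneg (mul_nonneg (pow_nonneg (Nat.cast_nonneg _) _) (pow_nonneg hin _))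
    (pow_nonneg (hy0.trans hyx) _)

/-- `Θ₃ ≥ 0`. [folklore] -/
theorem theta3_nonneg : 0 ≤ theta3 r k N q Dg deg a m := by
  unfold theta3
  refine mul_nonneg (mul_nonneg (pow_nonneg (Nat.cast_nonneg _) _) ?_) codeSum_nonneg
  refine mul_nonneg (mul_nonneg (Nat.cast_nonneg _) (pow_nonneg ?_ _)) (pow_nonneg (pow_nonneg ?_ _) _)
  · exact div_nonneg (Nat.cast_nonneg _) (Nat.cast_nonneg _)
  · exact prod_nonneg fun j _ => Nat.cast_nonneg _

end Quantities

end Literature.Computability.AlgebraicComplexity.KumarSaraf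

end
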